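import Literature.MathematicalPhysics.QuantumLattice.XXZGroundStateSpontaneousOrder
import Literature.MathematicalPhysics.QuantumLattice.XXZIsingAntiferromagnetThermalSpontaneousOrder
import Literature.MathematicalPhysics.QuantumLattice.XXZGroundStateIsingOrderSharp
import Literature.MathematicalPhysics.QuantumLattice.KaplanHorschVonDerLindenFieldBound
import Mathlib.LinearAlgebra.Eigenspace.Triangularizable
import HarnessLib

/-!
# Néel order ⟹ spontaneous staggered magnetisation in the GROUND STATES of the XXZ antiferromagnet on the
# ISING side (`Δ ≥ 1`): Koma–Tasaki 1993 Theorem 7.1 (Kaplan–Horsch–von der Linden) BY NAME — the non-commuting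
# order parameter `Σ_x(-1)^xSᶻ_x` — and the `z`-axis form of Corollary 7.2 at `Δ = 1`

T. Koma, H. Tasaki, *Symmetry breaking in Heisenberg antiferromagnets*, Commun. Math. Phys. **158** (1993) 191–214
(`KomaTasaki1993`, held `paper:doi-10-1007-bf02097237`), §7, p. 209:

> Let `Φ_Λ` and `Φ_Λ(B)` be ground states of the Hamiltonians (2.2) and (2.6), respectively. We define the long
> range order parameter in the ground state `Φ_Λ` as `σ = lim_{Λ↑ℤ^d} N⁻¹ √(Φ_Λ, (O_Λ)²Φ_Λ)` (7.1), where we take a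
> subsequence if necessary.  We assume i') `U_ΛΦ_Λ = Φ_Λ`, for `U_Λ` used in Sect. 2.  Kaplan, Horsch and von der
> Linden [11] proved the following.
> **Theorem 7.1 (Kaplan, Horsch and von der Linden).**  Consider an arbitrary sequence of models satisfying the
> above i') and the assumptions ii), iii) in Sect. 2.  Then `liminf_{B↓0} liminf_{Λ↑ℤ^d} N⁻¹(Φ_Λ(B), O_ΛΦ_Λ(B)) ≥ σ`. (7.2)

The abstract theorem is PROVED in the tree (`KomaTasaki.kaplanHorschVonDerLinden_limit`,
`KaplanHorschVonDerLindenFieldBound.lean`, seat `hubbard-cq-lit-1`; with Tasaki 2019 Theorems 2.1 / 3.5 and the primary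
source Kaplan–Horsch–von der Linden 1989 cited there).  Its hypotheses on the symmetric ground state `Φ_Λ` are only the
two vanishing odd moments `(Φ_Λ, O_ΛΦ_Λ) = (Φ_Λ, O_Λ³Φ_Λ) = 0` (from i')) and the long-range order
`(Φ_Λ, O_Λ²Φ_Λ) ≥ (μōN)²`.  This file applies it, BY NAME, to the model and order parameter of KT93 §1 in the regime
where the order parameter does NOT commute with the Hamiltonian and no continuous symmetry rotates it — the XXZ
antiferromagnet `H = JΣ_{⟨x,y⟩}(SˣSˣ + SʸSʸ + ΔSᶻSᶻ)`, `J > 0`, `Δ ≥ 1`, with the NÉEL order parameter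
`O_Λ = Σ_x(-1)^xSᶻ_x` and `U_Λ` the global half turn about the `y`-axis (`XXZKT.halfTurnY`, KT93 (2.3)/(2.5)):

* §1 **`Matrix.exists_groundState_eigenvector_of_symmetry_re_ge`** (general linear algebra): for Hermitian `A`, `Q`
  and any `U` commuting with both there is a unit ground state of `A` which is a `U`-EIGENVECTOR and has
  `Re Φ†QΦ ≥ Re ω_GS(Q)` (the top eigenspace of the compression of `Q` to the ground space is `U`-invariant).  This is
  how i') is met from the long-range order of the TRACIAL ground state when `U_Λ` is not Hermitian (a rotation by `π`
  of half-odd-integer spins squares to `-1`), complementing `Matrix.exists_groundState_eigenvector_re_ge`.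
* §2 `dotProduct_mulVec_eq_zero_of_anticommute` — a `U`-eigenvector has vanishing expectation of every `M` with
  `UM = -MU` (`U` unitary): the odd moments of KT93 (7.7)–(7.8).
* §3 `re_groundStateFunctional_stagSpin_mul_stagSpin_comp`, `exists_pos_eventually_le_of_hasStaggeredEvenTorusLRO_comp`
  (any component `α`; `α = 2` is the Néel order `HasStaggeredEvenTorusLRO (groundStateXXZCorrTorus 2 …)`).
* §4 ENGINE **`ground_neelOrder_ge_of_eventually_lro`** (KT93 Theorem 7.1 for quantum spins, any family of tori
  `N_k → ∞`, any `J, Δ`): an eventual floor `a N² ≤ Re ω_GS((O_Λ)²)`, `O_Λ = Σ_x(-1)^{σx}Sᶻ_x`, forces, for every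
  `B > 0`, `ε > 0`, eventually, EVERY unit ground state `Φ_B` of `H - B·O_Λ` to satisfy `N⁻¹Re Φ_B†O_ΛΦ_B ≥ √a - ε`.
* §5 THE THEOREMS: **`xxzAF_ground_spontaneousNeelMagnetisation`** (`d ≥ 2`, `S = n/2`, `(d,S) ≠ (2,½)`, `J > 0`,
  `Δ ≥ 1`; Néel order from the tree's `xxzAF_ground_neel_of_ne`, Kubo–Kishi / Björnberg–Ueltschi):
  `∃ σ > 0 ∀ B > 0 ∀ ε > 0`, eventually on `(ℤ/(2k+2)ℤ)^d`, every ground state `Φ_B` of `H - B·Σ_x(-1)^xSᶻ_x` has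
  `N⁻¹Re⟨Φ_B, Σ_x(-1)^xSᶻ_xΦ_B⟩ ≥ σ - ε`; `xxzAF_ground_spontaneousNeelMagnetisation_spinHalf_two` (`d = 2`, `S = ½`,
  `Δ ≥ 9/4`, the tree's certified Ising-side window `xxzAF_ground_neel_spinHalf_plaquette`); tracial form.
* §6 **`heisenbergAF_ground_spontaneousNeelMagnetisation`**: at `Δ = 1` the `z`-axis staggered field gives the SAME
  floor `√3 σ - ε` as the `x`-axis one (`XXZKT.heisenbergAF_ground_spontaneousStaggeredMagnetisation`) — the two sourced
  Hamiltonians are conjugate under the global quarter turn about the `y`-axis, which commutes with `JΣ𝐒_x·𝐒_y`.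

All `d ≥ 2` including `d = 2` (`S ≥ 1`; `S = ½` for `Δ ≥ 9/4`); ground states only (the `T > 0` version, `d ≥ 3`, is
`XXZIsingAntiferromagnetThermalSpontaneousOrder.lean`).  No definitions, no named facts, no sorry.

## References
* [KomaTasaki1993] T. Koma, H. Tasaki, Commun. Math. Phys. **158** (1993) 191–214, §1 (1.1)–(1.2), §2 (2.3)–(2.6),
  §7 (7.1), Theorem 7.1 (7.2) and its proof (7.4)–(7.10), Corollary 7.2, p. 193.
* [KaplanHorschVonDerLinden1989] T. A. Kaplan, P. Horsch, W. von der Linden, J. Phys. Soc. Jpn. **58** (1989) 3894–3898.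
* [Tasaki2019Tower] H. Tasaki, J. Stat. Phys. **174** (2019) 735–761, Theorems 2.1 and 3.5, §3.2.
* [KuboKishi1988] K. Kubo, T. Kishi, Phys. Rev. Lett. **61** (1988) 2585.
* [BjornbergUeltschi2022] J. E. Björnberg, D. Ueltschi, arXiv:2204.12896, Theorem 3.2.
* [WischmannMullerhartmann1991] H.-A. Wischmann, E. Müller-Hartmann, J. Phys. I France **1** (1991) 647–657.
* [Tasaki2020] H. Tasaki, *Physics and Mathematics of Quantum Many-Body Systems*, Springer 2020, §2.1–§2.5, App. A.2.
-/

noncomputable section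

open Matrix Finset Filter Topology WithLp
open scoped ComplexOrder Matrix.Norms.L2Operator InnerProductSpace ComplexConjugate
open Literature.MathematicalPhysics.QuantumLattice Literature.MathematicalPhysics.QuantumLattice.SpinOperators
  Literature.MathematicalPhysics.QuantumLattice.KomaTasaki Literature.Probability.LatticeModels

namespace Literature.MathematicalPhysics.QuantumLattice

/-! ### §1. A symmetric long-range-ordered ground state (general) -/

section General

variable {n : Type*} [Fintype n] [DecidableEq n]

/-- `⟨w, (toEuclideanCLM U) z⟩ = ⟨(toEuclideanCLM Uᴴ) w, z⟩`. [cite: Tasaki2020, App. A.2] -/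
theorem inner_toEuclideanCLM_right_eq_conjTranspose_left (U : Matrix n n ℂ) (w z : EuclideanSpace ℂ n) :
    ⟪w, toEuclideanCLM (n := n) (𝕜 := ℂ) U z⟫_ℂ = ⟪toEuclideanCLM (n := n) (𝕜 := ℂ) Uᴴ w, z⟫_ℂ := by
  rw [← Matrix.star_eq_conjTranspose, map_star, ContinuousLinearMap.star_eq_adjoint,
    ContinuousLinearMap.adjoint_inner_left]

/-- **A ground state that is symmetric AND long-range ordered.**  Let `A` (the Hamiltonian) and `Q` be Hermitian and
`U` ANY matrix commuting with both (`UA = AU`, `UQ = QU`; e.g. a unitary symmetry of `A` with `UOU* = -O`, `Q = O²`).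
Then there is a unit ground-state vector `Φ` of `A` which is an EIGENVECTOR OF `U` and whose expectation of `Q` is at
least the tracial ground-state average: `Re ω_GS(Q) ≤ Re Φ†QΦ` (`ω_GS = groundStateFunctional A`).  Proof: the
compression `T = P_K Q P_K` of `Q` to the ground space `K` is symmetric; its top eigenspace `W` is `U`-invariant (`U`
and `U*` preserve `K`, `U` preserves `Kᗮ`); any eigenvector of `U|_W` (which exists over `ℂ`) will do, since the average
of the eigenvalues of `T` — which is `Re ω_GS(Q)` — is at most the largest one.  This supplies the `U_Λ`-symmetric
long-range-ordered ground state `Φ_Λ` of KT93 §7 i') from the long-range order of the tracial ground state (compare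
`Matrix.exists_groundState_eigenvector_re_ge`, the case of a HERMITIAN conserved charge).
[cite: KomaTasaki1993, §7 i'), (7.1)] [cite: Tasaki2020, §2.1, App. A.2] -/
theorem _root_.Matrix.exists_groundState_eigenvector_of_symmetry_re_ge [Nonempty n] {A U Q : Matrix n n ℂ}
    (hA : A.IsHermitian) (hUA : U * A = A * U) (hQ : Q.IsHermitian) (hUQ : U * Q = Q * U) :
    ∃ Φ : n → ℂ, star Φ ⬝ᵥ Φ = 1 ∧ A *ᵥ Φ = (A.groundEnergy : ℂ) • Φ ∧
      (∃ c : ℂ, U *ᵥ Φ = c • Φ) ∧ (A.groundStateFunctional Q).re ≤ (star Φ ⬝ᵥ (Q *ᵥ Φ)).re := by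
  -- the Euclidean copy `K` of the ground space, `P₀ = projMatrix K`
  set K : Submodule ℂ (EuclideanSpace ℂ n) :=
    A.groundSpace.map ((WithLp.linearEquiv 2 ℂ (n → ℂ)).symm : (n → ℂ) →ₗ[ℂ] EuclideanSpace ℂ n) with hK
  have hPK : A.groundProj = projMatrix K := groundProj_eq A
  have hmemK : ∀ v : EuclideanSpace ℂ n, v ∈ K ↔ (ofLp v : n → ℂ) ∈ A.groundSpace := by
    intro v
    rw [hK, Submodule.mem_map]
    constructor
    · rintro ⟨u, hu, huv⟩
      rw [← huv]
      exact hu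
    · intro hv
      exact ⟨ofLp v, hv, rfl⟩
  have hKne : K ≠ ⊥ := by
    intro hbot
    apply groundSpace_ne_bot_holds hA
    rw [Submodule.eq_bot_iff] at hbot ⊢
    intro v hv
    have h := hbot (toLp 2 v) ((hmemK _).2 hv)
    have h' := congrArg ofLp h
    simpa using h'
  set m : ℕ := Module.finrank ℂ K with hm_def
  have hm0 : m ≠ 0 := fun h => hKne (Submodule.finrank_eq_zero.1 h)
  have hmpos : (0 : ℝ) < m := by exact_mod_cast Nat.pos_of_ne_zero hm0
  -- the operators on `ℓ²`
  set TQ : EuclideanSpace ℂ n →L[ℂ] EuclideanSpace ℂ n := toEuclideanCLM (n := n) (𝕜 := ℂ) Q with hTQ_def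
  set TU : EuclideanSpace ℂ n →L[ℂ] EuclideanSpace ℂ n := toEuclideanCLM (n := n) (𝕜 := ℂ) U with hTU_def
  have hQsym : ∀ x y : EuclideanSpace ℂ n, ⟪TQ x, y⟫_ℂ = ⟪x, TQ y⟫_ℂ := fun x y =>
    ContinuousLinearMap.isSelfAdjoint_iff_isSymmetric.mp ((Matrix.isSelfAdjoint_toEuclideanCLM_iff Q).mpr hQ) x y
  have hUQ' : ∀ x : EuclideanSpace ℂ n, TQ (TU x) = TU (TQ x) := fun x => by
    change (toEuclideanCLM (n := n) (𝕜 := ℂ) Q * toEuclideanCLM (n := n) (𝕜 := ℂ) U) x =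
      (toEuclideanCLM (n := n) (𝕜 := ℂ) U * toEuclideanCLM (n := n) (𝕜 := ℂ) Q) x
    rw [← map_mul, ← map_mul, hUQ]
  -- `U` and `Uᴴ` preserve `K`; `U` preserves `Kᗮ`
  have hU'A : Uᴴ * A = A * Uᴴ := by
    have h := congrArg conjTranspose hUA
    rw [conjTranspose_mul, conjTranspose_mul, hA.eq] at h
    exact h.symm
  have hUK : ∀ v ∈ K, (TU : EuclideanSpace ℂ n →ₗ[ℂ] EuclideanSpace ℂ n) v ∈ K := by
    intro v hv
    rw [hmemK] at hv ⊢
    exact mulVec_mem_groundSpace_of_commute hUA hv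
  have hUadjK : ∀ w ∈ K, toEuclideanCLM (n := n) (𝕜 := ℂ) Uᴴ w ∈ K := by
    intro w hw
    rw [hmemK] at hw ⊢
    exact mulVec_mem_groundSpace_of_commute hU'A hw
  have hUperp : ∀ z ∈ Kᗮ, TU z ∈ Kᗮ := by
    intro z hz
    rw [Submodule.mem_orthogonal]
    intro w hw
    rw [hTU_def, inner_toEuclideanCLM_right_eq_conjTranspose_left]
    exact Submodule.inner_right_of_mem_orthogonal (hUadjK w hw) hz
  -- the compression `T = P_K Q|_K` of `Q` to `K`, a symmetric operator on `K`
  set T : K →ₗ[ℂ] K := ((K.orthogonalProjectionOnto.comp (TQ.comp K.subtypeL) : K →L[ℂ] K) : K →ₗ[ℂ] K)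
    with hT_def
  have hT_apply : ∀ v : K, T v = K.orthogonalProjectionOnto (TQ (v : EuclideanSpace ℂ n)) := fun v => rfl
  have hT_inner : ∀ v w : K, ⟪v, T w⟫_ℂ = ⟪(v : EuclideanSpace ℂ n), TQ (w : EuclideanSpace ℂ n)⟫_ℂ := by
    intro v w
    rw [hT_apply, Submodule.inner_orthogonalProjectionOnto_eq_of_mem_left]
  have hTsym : LinearMap.IsSymmetric (𝕜 := ℂ) (E := ↥K) T := by
    intro v w
    rw [hT_inner, ← inner_conj_symm, hT_inner, ← hQsym, inner_conj_symm]
  -- its eigenvector basis; the largest eigenvalue `λ`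
  set b := hTsym.eigenvectorBasis rfl with hb_def
  set ev : Fin m → ℝ := hTsym.eigenvalues rfl with hev_def
  have hnorm : ∀ i, ‖(b i : EuclideanSpace ℂ n)‖ = 1 := fun i => by
    have h1 : ‖b i‖ = 1 := b.orthonormal.1 i
    exact h1
  have hbT : ∀ i, T (b i) = ((ev i : ℝ) : ℂ) • b i := fun i => hTsym.apply_eigenvectorBasis rfl i
  have hbQ : ∀ i, (⟪(b i : EuclideanSpace ℂ n), TQ (b i : EuclideanSpace ℂ n)⟫_ℂ).re = ev i := by
    intro i
    rw [← hT_inner, hbT, Submodule.coe_inner, Submodule.coe_smul, inner_smul_right, inner_self_eq_norm_sq_to_K,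
      hnorm i]
    simp
  obtain ⟨i₀, -, hi₀⟩ := Finset.exists_max_image (Finset.univ : Finset (Fin m)) ev
    ⟨⟨0, Nat.pos_of_ne_zero hm0⟩, Finset.mem_univ _⟩
  -- the average of `Q` over the ground space is at most `λ = ev i₀`
  have htrO : (A.groundProj * Q).trace =
      ∑ i, ⟪(b i : EuclideanSpace ℂ n), TQ (b i : EuclideanSpace ℂ n)⟫_ℂ := by
    rw [hPK]; exact trace_projMatrix_mul_eq_sum K b Q
  have htr1 : A.groundProj.trace = (m : ℂ) := by
    have h := trace_projMatrix_mul_eq_sum K b 1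
    rw [Matrix.mul_one, map_one] at h
    rw [hPK, h]
    simp only [ContinuousLinearMap.one_def, ContinuousLinearMap.coe_id', id_eq, inner_self_eq_norm_sq_to_K, hnorm,
      Finset.sum_const, Finset.card_univ, Fintype.card_fin, hm_def]
    simp
  have havg : (A.groundStateFunctional Q).re * m = ∑ i, ev i := by
    have hre : ((m : ℂ)⁻¹ * ∑ i, ⟪(b i : EuclideanSpace ℂ n), TQ (b i : EuclideanSpace ℂ n)⟫_ℂ).re =
        (∑ i, ⟪(b i : EuclideanSpace ℂ n), TQ (b i : EuclideanSpace ℂ n)⟫_ℂ).re / m := by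
      rw [mul_comm, ← div_eq_mul_inv]
      exact Complex.div_natCast_re _ m
    rw [groundStateFunctional_apply, htr1, htrO, hre, div_mul_cancel₀ _ hmpos.ne', Complex.re_sum]
    exact Finset.sum_congr rfl fun i _ => hbQ i
  have havg_le : (A.groundStateFunctional Q).re ≤ ev i₀ := by
    have h1 : ∑ i, ev i ≤ ∑ _i : Fin m, ev i₀ := Finset.sum_le_sum fun i _ => hi₀ i (Finset.mem_univ i)
    rw [Finset.sum_const, Finset.card_univ, Fintype.card_fin, nsmul_eq_mul, ← havg] at h1
    nlinarith
  -- the top eigenspace `W` of `T` is invariant under `U`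
  set UK : K →ₗ[ℂ] K := (TU : EuclideanSpace ℂ n →ₗ[ℂ] EuclideanSpace ℂ n).restrict hUK with hUK_def
  set W : Submodule ℂ K := Module.End.eigenspace T ((ev i₀ : ℝ) : ℂ) with hW_def
  have hmemW : ∀ v : K, v ∈ W ↔ T v = ((ev i₀ : ℝ) : ℂ) • v := fun v => Module.End.mem_eigenspace_iff
  have hW : ∀ v ∈ W, UK v ∈ W := by
    intro v hv
    rw [hmemW] at hv ⊢
    apply Subtype.ext
    -- `Q v = λ v + z`, `z ⊥ K`; `P(U Q v) = λ U v + P(U z) = λ U v`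
    have hz : TQ (v : EuclideanSpace ℂ n) - K.starProjection (TQ (v : EuclideanSpace ℂ n)) ∈ Kᗮ :=
      Submodule.sub_starProjection_mem_orthogonal _
    have hPv : K.starProjection (TQ (v : EuclideanSpace ℂ n)) = ((ev i₀ : ℝ) : ℂ) • (v : EuclideanSpace ℂ n) := by
      rw [Submodule.starProjection_apply, ← hT_apply, hv, Submodule.coe_smul]
    have hdecomp : TQ (TU (v : EuclideanSpace ℂ n)) =
        ((ev i₀ : ℝ) : ℂ) • TU (v : EuclideanSpace ℂ n) +
          TU (TQ (v : EuclideanSpace ℂ n) - K.starProjection (TQ (v : EuclideanSpace ℂ n))) := by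
      rw [hUQ', map_sub, hPv, map_smul]
      abel
    have hUz : K.orthogonalProjectionOnto
        (TU (TQ (v : EuclideanSpace ℂ n) - K.starProjection (TQ (v : EuclideanSpace ℂ n)))) = 0 :=
      (Submodule.orthogonalProjectionOnto_eq_zero_iff).2 (hUperp _ hz)
    change (K.orthogonalProjectionOnto (TQ (TU (v : EuclideanSpace ℂ n))) : EuclideanSpace ℂ n) =
      ((ev i₀ : ℝ) : ℂ) • TU (v : EuclideanSpace ℂ n)
    rw [hdecomp, map_add, hUz, add_zero, map_smul, Submodule.coe_smul]
    congr 1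
    have hmem : TU (v : EuclideanSpace ℂ n) ∈ K := hUK v v.2
    have := Submodule.orthogonalProjectionOnto_mem_subspace_eq_self (⟨TU (v : EuclideanSpace ℂ n), hmem⟩ : K)
    exact congrArg Subtype.val this
  -- an eigenvector of `U` inside `W`
  have hbi₀W : b i₀ ∈ W := (hmemW _).2 (hbT i₀)
  have hbi₀ne : (b i₀ : K) ≠ 0 := fun h => by
    have := hnorm i₀
    rw [h, Submodule.coe_zero, norm_zero] at this
    exact zero_ne_one this
  haveI : Nontrivial W := ⟨⟨⟨b i₀, hbi₀W⟩, 0, fun h => hbi₀ne (congrArg Subtype.val h)⟩⟩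
  set UW : W →ₗ[ℂ] W := UK.restrict hW with hUW_def
  obtain ⟨c, hc⟩ := Module.End.exists_eigenvalue UW
  obtain ⟨x, hxW, hx0⟩ := hc.exists_hasEigenvector
  have hUx : UW x = c • x := Module.End.mem_eigenspace_iff.1 hxW
  -- the vector `Φ₀ = x` in `ℓ²`, and its normalisation
  set Φ₀ : EuclideanSpace ℂ n := ((x : K) : EuclideanSpace ℂ n) with hΦ₀
  have hΦ₀K : Φ₀ ∈ K := (x : K).2
  have hΦ₀ne : Φ₀ ≠ 0 := fun h => hx0 (Subtype.ext (Subtype.ext h))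
  have hUΦ₀ : TU Φ₀ = c • Φ₀ := by
    have h1 := congrArg (fun y : W => ((y : K) : EuclideanSpace ℂ n)) hUx
    exact h1
  have hTΦ₀ : T (x : K) = ((ev i₀ : ℝ) : ℂ) • (x : K) := (hmemW _).1 (x.2)
  have hQΦ₀ : (⟪Φ₀, TQ Φ₀⟫_ℂ).re = ev i₀ * ‖Φ₀‖ ^ 2 := by
    have hxx : (⟪((x : K) : EuclideanSpace ℂ n), ((x : K) : EuclideanSpace ℂ n)⟫_ℂ).re =
        ‖((x : K) : EuclideanSpace ℂ n)‖ ^ 2 := by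
      rw [inner_self_eq_norm_sq_to_K]; norm_cast
    rw [hΦ₀, ← hT_inner, hTΦ₀, Submodule.coe_inner, Submodule.coe_smul, inner_smul_right, Complex.re_ofReal_mul, hxx]
  have hnΦ₀ : 0 < ‖Φ₀‖ := norm_pos_iff.2 hΦ₀ne
  set Φ : EuclideanSpace ℂ n := ((‖Φ₀‖⁻¹ : ℝ) : ℂ) • Φ₀ with hΦ_def
  have hΦnorm : ‖Φ‖ = 1 := by
    rw [hΦ_def, norm_smul, Complex.norm_real, Real.norm_eq_abs, abs_inv, abs_of_pos hnΦ₀, inv_mul_cancel₀ hnΦ₀.ne']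
  have hΦK : Φ ∈ K := Submodule.smul_mem K _ hΦ₀K
  have hUΦ : TU Φ = c • Φ := by
    rw [hΦ_def, map_smul, hUΦ₀, smul_comm]
  have hQΦ : (⟪Φ, TQ Φ⟫_ℂ).re = ev i₀ := by
    rw [hΦ_def, map_smul, inner_smul_left, inner_smul_right, ← mul_assoc, Complex.conj_ofReal, ← Complex.ofReal_mul,
      Complex.re_ofReal_mul, hQΦ₀, ← pow_two, inv_pow]
    field_simp
  -- back to `n → ℂ`
  refine ⟨ofLp Φ, ?_, ?_, ⟨c, ?_⟩, ?_⟩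
  · rw [star_ofLp_dotProduct_ofLp, hΦnorm, one_pow, Complex.ofReal_one]
  · exact (mem_groundSpace_iff A _).1 ((hmemK _).1 hΦK)
  · have h := congrArg ofLp hUΦ
    rw [hTU_def, ofLp_toEuclideanCLM, WithLp.ofLp_smul] at h
    exact h
  · rw [← inner_toEuclideanCLM_eq_dotProduct, ← hTQ_def, hQΦ]
    exact havg_le

end General

/-! ### §2. Odd moments vanish on a `U`-eigenvector when `U` anticommutes with the observable -/

section OddMoments

variable {m : Type*} [Fintype m] [DecidableEq m]

/-- **KT93 (7.7)–(7.8): the odd moments vanish.**  If `U` is unitary, `UM = -MU`, and `Φ` is a unit `U`-eigenvector,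
then `Φ†MΦ = 0` (`Φ†MΦ = -|c|²Φ†MΦ` with `|c| = 1`). [cite: KomaTasaki1993, §7 (7.7)–(7.8), §2 (2.5)] -/
theorem dotProduct_mulVec_eq_zero_of_anticommute {U M : Matrix m m ℂ} {Φ : m → ℂ} {c : ℂ}
    (hU : Uᴴ * U = 1) (hUM : U * M = -(M * U)) (hΦ : star Φ ⬝ᵥ Φ = 1) (hUΦ : U *ᵥ Φ = c • Φ) :
    star Φ ⬝ᵥ (M *ᵥ Φ) = 0 := by
  -- `|c|² = 1`
  have hcc : (starRingEnd ℂ) c * c = 1 := by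
    have h1 : star (U *ᵥ Φ) ⬝ᵥ (U *ᵥ Φ) = 1 := by
      rw [star_mulVec, ← dotProduct_mulVec, mulVec_mulVec, hU, one_mulVec, hΦ]
    rw [hUΦ, star_smul, smul_dotProduct, dotProduct_smul, hΦ, smul_eq_mul, smul_eq_mul, mul_one] at h1
    rw [← h1, Complex.star_def]
  -- `M = -(Uᴴ M U)`
  have hM : M = -(Uᴴ * M * U) := by
    have h : Uᴴ * (U * M) = Uᴴ * -(M * U) := by rw [hUM]
    rw [← Matrix.mul_assoc, hU, Matrix.one_mul, Matrix.mul_neg, ← Matrix.mul_assoc] at h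
    exact h
  have hkey : star Φ ⬝ᵥ (M *ᵥ Φ) = -((starRingEnd ℂ) c * c * (star Φ ⬝ᵥ (M *ᵥ Φ))) := by
    conv_lhs => rw [hM]
    rw [neg_mulVec, dotProduct_neg, ← mulVec_mulVec, ← mulVec_mulVec, hUΦ, mulVec_smul, mulVec_smul,
      dotProduct_smul, dotProduct_mulVec, ← star_mulVec, hUΦ, star_smul, smul_dotProduct, Complex.star_def, smul_eq_mul,
      smul_eq_mul]
    ring
  rw [hcc, one_mul] at hkey
  have h2 : (2 : ℂ) * (star Φ ⬝ᵥ (M *ᵥ Φ)) = 0 := by linear_combination hkey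
  exact (mul_eq_zero.1 h2).resolve_left two_ne_zero

omit [DecidableEq m] in
/-- `UM = -MU ⟹ UM³ = -M³U`. [cite: KomaTasaki1993, §7 (7.8) (l = 3)] -/
theorem mul_cube_eq_neg_of_anticommute {U M : Matrix m m ℂ} (hUM : U * M = -(M * U)) :
    U * (M * M * M) = -(M * M * M * U) := by
  rw [← Matrix.mul_assoc, ← Matrix.mul_assoc, hUM, Matrix.neg_mul, Matrix.neg_mul, Matrix.mul_assoc (M) U M, hUM,
    Matrix.mul_neg, Matrix.neg_mul, neg_neg, ← Matrix.mul_assoc, Matrix.mul_assoc (M * M) U M, hUM, Matrix.mul_neg,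
    ← Matrix.mul_assoc]

/-- `UOU* = -O` with `U*U = 1 = UU*` gives `UO = -OU`. [cite: KomaTasaki1993, §2 (2.5)] -/
theorem mul_eq_neg_mul_of_conj_eq_neg {U O : Matrix m m ℂ} (hU : Uᴴ * U = 1) (h : U * O * Uᴴ = -O) :
    U * O = -(O * U) := by
  calc U * O = U * O * (Uᴴ * U) := by rw [hU, Matrix.mul_one]
    _ = U * O * Uᴴ * U := by simp only [Matrix.mul_assoc]
    _ = -(O * U) := by rw [h, Matrix.neg_mul]

/-- `UHU* = H` with `U*U = 1` gives `UH = HU`. [cite: KomaTasaki1993, §2 (2.3)] -/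
theorem mul_eq_mul_of_conj_eq {U H : Matrix m m ℂ} (hU : Uᴴ * U = 1) (h : U * H * Uᴴ = H) : U * H = H * U := by
  calc U * H = U * H * (Uᴴ * U) := by rw [hU, Matrix.mul_one]
    _ = U * H * Uᴴ * U := by simp only [Matrix.mul_assoc]
    _ = H * U := by rw [h]

end OddMoments

namespace XXZKT

variable {d : ℕ}

/-! ### §3. Ground-state long-range order of a component, in Koma–Tasaki's normalisation -/

section GroundLRO

/-- `|Λ| = L^d`. [cite: KomaTasaki1993, §2 (2.1)] -/
private theorem card_torusSite'' (L : ℕ) [NeZero L] : Fintype.card (TorusSite d L) = L ^ d := by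
  rw [Fintype.card_pi, prod_const, ZMod.card, card_univ, Fintype.card_fin]

/-- KT93 (7.1) for the tracial ground state, any component `α`:
`Re ω_GS((Σ_x(-1)^{σx}S^α_x)²) = Σ_{x,y}(-1)^{σx}(-1)^{σy} Re ω_GS(S^α_xS^α_y)`. [cite: KomaTasaki1993, §7 (7.1), §1 (1.7)] -/
theorem re_groundStateFunctional_stagSpin_mul_stagSpin_comp (α : Fin 3) (L : ℕ) [NeZero L] (n : ℕ) (J Δ : ℝ)
    (σ : TorusSite d L → ℕ) :
    ((xxzHamiltonian n (torusGraph d L) J Δ).groundStateFunctional (stagSpin n σ α * stagSpin n σ α)).re =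
      ∑ x : TorusSite d L, ∑ y : TorusSite d L,
        stagSign σ x * stagSign σ y * groundStateXXZCorrTorus α (d := d) L n J Δ x y := by
  rw [stagSpin, Finset.sum_mul_sum, map_sum, Complex.re_sum]
  refine Finset.sum_congr rfl fun x _ => ?_
  rw [map_sum, Complex.re_sum]
  refine Finset.sum_congr rfl fun y _ => ?_
  rw [Matrix.smul_mul, Matrix.mul_smul, smul_smul, LinearMap.map_smul, smul_eq_mul, ← Complex.ofReal_mul,
    Complex.re_ofReal_mul, groundStateXXZCorrTorus_of_neZero]

/-- `Re ω_GS((Σ_x(-1)^{σx}S^α_x)²) ≥ 0`. [cite: KomaTasaki1993, §7 (7.1)] -/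
theorem re_groundStateFunctional_stagSpin_mul_stagSpin_comp_nonneg (α : Fin 3) (L : ℕ) [NeZero L] (n : ℕ)
    (J Δ : ℝ) (σ : TorusSite d L → ℕ) :
    0 ≤ ((xxzHamiltonian n (torusGraph d L) J Δ).groundStateFunctional (stagSpin n σ α * stagSpin n σ α)).re :=
  re_groundStateFunctional_mul_self_nonneg _ (isHermitian_stagSpin n σ α)

/-- **Staggered ground-state LRO of the component `α` in KT's form**: `HasStaggeredEvenTorusLRO` of
`groundStateXXZCorrTorus α` gives `a > 0` with `a N² ≤ Re ω_GS((Σ_x(-1)^xS^α_x)²)` on all large even tori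
`(ℤ/(2k+2)ℤ)^d` (`α = 2`: Néel order). [cite: KomaTasaki1993, §7 (7.1), §1 (1.7)] [cite: DLS1978, §1] -/
theorem exists_pos_eventually_le_of_hasStaggeredEvenTorusLRO_comp (α : Fin 3) {n : ℕ} {J Δ : ℝ}
    (h : HasStaggeredEvenTorusLRO (fun L x y => groundStateXXZCorrTorus α (d := d) L n J Δ x y)) :
    ∃ a : ℝ, 0 < a ∧ ∀ᶠ k : ℕ in atTop,
      a * (Fintype.card (TorusSite d (2 * k + 2)) : ℝ) ^ 2 ≤
        ((xxzHamiltonian n (torusGraph d (2 * k + 2)) J Δ).groundStateFunctional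
          (stagSpin n (torusParityExp d (2 * k + 2)) α * stagSpin n (torusParityExp d (2 * k + 2)) α)).re := by
  rw [hasStaggeredEvenTorusLRO_iff_holds] at h
  obtain ⟨f, hf, hpos⟩ : ∃ f : ℕ → ℝ, (∀ k, f k =
      (∑ x : TorusSite d (2 * k + 2), ∑ y : TorusSite d (2 * k + 2),
          (-1 : ℝ) ^ (∑ i, (x i).val) * (-1) ^ (∑ i, (y i).val) *
            groundStateXXZCorrTorus α (d := d) (2 * k + 2) n J Δ x y) / ((2 * k + 2 : ℕ) : ℝ) ^ (2 * d)) ∧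
      0 < liminf f atTop := ⟨_, fun _ => rfl, h⟩
  have hsum : ∀ k : ℕ, (∑ x : TorusSite d (2 * k + 2), ∑ y : TorusSite d (2 * k + 2),
      (-1 : ℝ) ^ (∑ i, (x i).val) * (-1) ^ (∑ i, (y i).val) *
        groundStateXXZCorrTorus α (d := d) (2 * k + 2) n J Δ x y) =
      ((xxzHamiltonian n (torusGraph d (2 * k + 2)) J Δ).groundStateFunctional
        (stagSpin n (torusParityExp d (2 * k + 2)) α * stagSpin n (torusParityExp d (2 * k + 2)) α)).re :=
    fun k => (re_groundStateFunctional_stagSpin_mul_stagSpin_comp α (2 * k + 2) n J Δ (torusParityExp d (2 * k + 2))).symm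
  have hcard : ∀ k : ℕ, ((2 * k + 2 : ℕ) : ℝ) ^ (2 * d) = (Fintype.card (TorusSite d (2 * k + 2)) : ℝ) ^ 2 :=
    fun k => by rw [card_torusSite'', Nat.cast_pow, ← pow_mul, mul_comm d 2]
  have hnonneg : ∀ k : ℕ, 0 ≤ f k := fun k => by
    rw [hf, hsum]
    exact div_nonneg (re_groundStateFunctional_stagSpin_mul_stagSpin_comp_nonneg α _ n J Δ _) (by positivity)
  have hcl : liminf f atTop / 2 < liminf f atTop := half_lt_self hpos
  have hev := eventually_lt_of_lt_liminf hcl (isBoundedUnder_of ⟨0, fun k => hnonneg k⟩)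
  refine ⟨liminf f atTop / 2, half_pos hpos, hev.mono fun k hk => ?_⟩
  have hN : (0 : ℝ) < (Fintype.card (TorusSite d (2 * k + 2)) : ℝ) ^ 2 := by
    have : (0 : ℝ) < Fintype.card (TorusSite d (2 * k + 2)) := Nat.cast_pos.mpr Fintype.card_pos
    positivity
  have hfk : f k * (Fintype.card (TorusSite d (2 * k + 2)) : ℝ) ^ 2 =
      ((xxzHamiltonian n (torusGraph d (2 * k + 2)) J Δ).groundStateFunctional
        (stagSpin n (torusParityExp d (2 * k + 2)) α * stagSpin n (torusParityExp d (2 * k + 2)) α)).re := by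
    rw [hf, hsum, hcard, div_mul_cancel₀ _ hN.ne']
  rw [← hfk]
  exact mul_le_mul_of_nonneg_right hk.le hN.le

end GroundLRO

/-! ### §4. The engine: KT93 Theorem 7.1 (Kaplan–Horsch–von der Linden) for quantum spins -/

section Engine

/-- `Re Φ†O²Φ ≤ (s|Λ|)²` for a unit `Φ` and `O = Σ_x(-1)^{σx}S^α_x` (`‖O‖ ≤ s|Λ|`). [cite: KomaTasaki1993, §2 ii)] -/
theorem re_dotProduct_stagSpin_sq_mulVec_le {Λ : Type*} [Fintype Λ] [DecidableEq Λ] (n : ℕ) (σ : Λ → ℕ) (α : Fin 3)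
    {Φ : TensorIndex Λ (n + 1) → ℂ} (hΦ : star Φ ⬝ᵥ Φ = 1) :
    (star Φ ⬝ᵥ (stagSpin n σ α *ᵥ (stagSpin n σ α *ᵥ Φ))).re ≤ (sNorm n * Fintype.card Λ) ^ 2 := by
  have h1 : (star Φ ⬝ᵥ (stagSpin n σ α *ᵥ (stagSpin n σ α *ᵥ Φ))).re =
      ‖(toLp 2 (stagSpin n σ α *ᵥ Φ) : SpinSpace Λ (n + 1))‖ ^ 2 := by
    rw [norm_toLp_sq_eq_re_dotProduct, Matrix.star_mulVec, ← Matrix.dotProduct_mulVec, (isHermitian_stagSpin n σ α).eq]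
  rw [h1]
  have h2 : ‖(toLp 2 (stagSpin n σ α *ᵥ Φ) : SpinSpace Λ (n + 1))‖ ≤ sNorm n * Fintype.card Λ := by
    rw [← toEuclideanCLM_toLp]
    refine (ContinuousLinearMap.le_opNorm _ _).trans ?_
    rw [Matrix.l2_opNorm_toEuclideanCLM, norm_toLp_eq_one_of_dotProduct hΦ, mul_one]
    exact norm_stagSpin_le n σ α
  exact pow_le_pow_left₀ (norm_nonneg _) h2 2

/-- `(μ s N)² ≤ X ≤ (s N)²` with `s N > 0` forces `μ ≤ 1`. [cite: KomaTasaki1994, §2.3 iv) (2.17)] -/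
theorem mu_le_one_of_sq_le {μ s N X : ℝ} (hsN : 0 < s * N) (h1 : (μ * s * N) ^ 2 ≤ X) (h2 : X ≤ (s * N) ^ 2) :
    μ ≤ 1 := by
  by_contra hμ1
  rw [not_le] at hμ1
  have h3 : s * N < μ * s * N := by
    have := mul_lt_mul_of_pos_right hμ1 hsN
    rw [one_mul, ← mul_assoc] at this
    exact this
  have h4 : (s * N) * (s * N) < (μ * s * N) * (μ * s * N) := mul_lt_mul'' h3 h3 hsN.le hsN.le
  simp only [pow_two] at h1 h2
  linarith

/-- **KT93 THEOREM 7.1 (KAPLAN–HORSCH–VON DER LINDEN) FOR QUANTUM SPINS (engine).**  Along any sequence of tori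
`Λ_k = (ℤ/L_kℤ)^d` with `N_k → ∞`, sign exponents `σ_k`, and `H_k = xxzHamiltonian n (torusGraph d L_k) J Δ` (any `J`,
`Δ`): if the tracial ground states have the eventual long-range-order floor `a N_k² ≤ Re ω_GS((O_k)²)` for the `z`-axis
order parameter `O_k = Σ_x(-1)^{σ_k x}Sᶻ_x` (which does NOT commute with `H_k`), `a > 0`, then for every field `B > 0`
and every `ε > 0`, eventually in `k`, EVERY unit ground state `Φ_B` of `H_k - B·O_k` satisfies
`N_k⁻¹Re Φ_B†O_kΦ_B ≥ √a - ε` — `liminf_k N_k⁻¹(Φ_k(B), O_kΦ_k(B)) ≥ σ = √a` for every `B > 0`, a fortiori (7.2).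
Proof, by name: a ground eigenstate `Φ` of `H_k` which is an eigenvector of the half turn `U` about the `y`-axis
(`UHU* = H`, `UOU* = -O`: `halfTurnY_conj_xxzHamiltonian`, `halfTurnY_conj_stagSpin_two`) with
`Re Φ†O²Φ ≥ Re ω_GS(O²)` (§1), whose odd moments vanish (§2) — KT93 i') —, then
`KomaTasaki.kaplanHorschVonDerLinden_limit` (the trial state `(Φ + OΦ/‖OΦ‖)/√2`, (7.4)–(7.10), with the tree's
Horsch–von der Linden constant). [cite: KomaTasaki1993, Theorem 7.1 (7.2), (7.4)–(7.10), i')]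
[cite: KaplanHorschVonDerLinden1989, main theorem] [cite: Tasaki2019Tower, Theorems 2.1, 3.5] -/
theorem ground_neelOrder_ge_of_eventually_lro {n : ℕ} {J Δ a : ℝ} (Lk : ℕ → ℕ) [∀ k, NeZero (Lk k)]
    (σ : ∀ k, TorusSite d (Lk k) → ℕ) (ha : 0 < a)
    (hN : Tendsto (fun k => Fintype.card (TorusSite d (Lk k))) atTop atTop)
    (hlro : ∀ᶠ k : ℕ in atTop, a * (Fintype.card (TorusSite d (Lk k)) : ℝ) ^ 2 ≤
      ((xxzHamiltonian n (torusGraph d (Lk k)) J Δ).groundStateFunctional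
        (stagSpin n (σ k) 2 * stagSpin n (σ k) 2)).re)
    {B ε : ℝ} (hB : 0 < B) (hε : 0 < ε) :
    ∀ᶠ k : ℕ in atTop, ∀ ΦB : TensorIndex (TorusSite d (Lk k)) (n + 1) → ℂ, star ΦB ⬝ᵥ ΦB = 1 →
      (xxzHamiltonian n (torusGraph d (Lk k)) J Δ - (B : ℂ) • stagSpin n (σ k) 2) *ᵥ ΦB =
        ((xxzHamiltonian n (torusGraph d (Lk k)) J Δ - (B : ℂ) • stagSpin n (σ k) 2).groundEnergy : ℂ) • ΦB →
      Real.sqrt a - ε ≤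
        (star ΦB ⬝ᵥ (stagSpin n (σ k) 2 *ᵥ ΦB)).re / (Fintype.card (TorusSite d (Lk k)) : ℝ) := by
  set μ : ℝ := Real.sqrt a / sNorm n with hμ_def
  have hs : 0 < sNorm n := lt_of_lt_of_le zero_lt_one (one_le_sNorm n)
  have hμ : 0 < μ := div_pos (Real.sqrt_pos.2 ha) hs
  have hμs : μ * sNorm n = Real.sqrt a := by rw [hμ_def, div_mul_cancel₀ _ hs.ne']
  obtain ⟨N₀, hN₀⟩ := KomaTasaki.kaplanHorschVonDerLinden_limit.{0, 0} (2 * d + 2) (hbar d n J Δ) μ hμ hB hε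
  filter_upwards [hlro, Filter.tendsto_atTop.mp hN N₀] with k hk hNk ΦB hΦB hHB
  -- the objects on `Λ_k`
  set H₀ := xxzHamiltonian n (torusGraph d (Lk k)) J Δ with hH₀
  set O := stagSpin n (σ k) 2 with hO
  set U : Op (TorusSite d (Lk k)) (n + 1) := halfTurnY n with hU_def
  have hH₀herm : H₀.IsHermitian := xxzHamiltonian_isHermitian n _ J Δ
  have hOherm : O.IsHermitian := isHermitian_stagSpin n (σ k) 2
  have hUU : Uᴴ * U = 1 := halfTurnY_conjTranspose_mul n
  have hUH : U * H₀ = H₀ * U := mul_eq_mul_of_conj_eq hUU (halfTurnY_conj_xxzHamiltonian n _ J Δ)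
  have hUO : U * O = -(O * U) := mul_eq_neg_mul_of_conj_eq_neg hUU (halfTurnY_conj_stagSpin_two n (σ k))
  have hUOO : U * (O * O) = O * O * U := by
    rw [← Matrix.mul_assoc, hUO, Matrix.neg_mul, Matrix.mul_assoc, hUO, Matrix.mul_neg, neg_neg, Matrix.mul_assoc]
  -- the symmetric long-range-ordered ground eigenstate (§1) and its odd moments (§2)
  have hOOherm : (O * O).IsHermitian := by
    have h := Matrix.isHermitian_mul_conjTranspose_self O
    rwa [hOherm.eq] at h
  obtain ⟨Φ, hΦ, hHΦ, ⟨c, hUΦ⟩, hlroΦ⟩ :=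
    Matrix.exists_groundState_eigenvector_of_symmetry_re_ge hH₀herm hUH hOOherm hUOO
  -- its odd moments vanish (§2): KT93 i') ⟹ (7.7)–(7.8)
  have hO1 : star Φ ⬝ᵥ (O *ᵥ Φ) = 0 := dotProduct_mulVec_eq_zero_of_anticommute hUU hUO hΦ hUΦ
  have hO3 : star Φ ⬝ᵥ ((O * O * O) *ᵥ Φ) = 0 :=
    dotProduct_mulVec_eq_zero_of_anticommute hUU (mul_cube_eq_neg_of_anticommute hUO) hΦ hUΦ
  -- long-range order (7.1) with `σ_Λ ≥ μō = √a`, and `μ ≤ 1`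
  have hlro2 : (μ * sNorm n * (Fintype.card (TorusSite d (Lk k)) : ℝ)) ^ 2 ≤
      (star Φ ⬝ᵥ (O *ᵥ (O *ᵥ Φ))).re := by
    rw [hμs, mul_pow, Real.sq_sqrt ha.le, Matrix.mulVec_mulVec]
    exact hk.trans hlroΦ
  have hμ1 : μ ≤ 1 :=
    mu_le_one_of_sq_le (mul_pos hs (Nat.cast_pos.mpr Fintype.card_pos)) hlro2
      (re_dotProduct_stagSpin_sq_mulVec_le n (σ k) 2 hΦ)
  -- the data of KT93 §2 as operators on `ℓ²(Λ_k)`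
  set hx : TorusSite d (Lk k) → SpinSpace (TorusSite d (Lk k)) (n + 1) →L[ℂ] SpinSpace (TorusSite d (Lk k)) (n + 1) :=
    fun x => toEuclideanCLM (n := TensorIndex (TorusSite d (Lk k)) (n + 1)) (𝕜 := ℂ)
      (localHam n (torusGraph d (Lk k)) J Δ x) with hhx_def
  set ox : TorusSite d (Lk k) → SpinSpace (TorusSite d (Lk k)) (n + 1) →L[ℂ] SpinSpace (TorusSite d (Lk k)) (n + 1) :=
    fun x => toEuclideanCLM (n := TensorIndex (TorusSite d (Lk k)) (n + 1)) (𝕜 := ℂ)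
      ((stagSign (σ k) x : ℂ) • siteSpin n x 2) with hox_def
  have hsumh : (∑ x, hx x) = toEuclideanCLM (n := TensorIndex (TorusSite d (Lk k)) (n + 1)) (𝕜 := ℂ) H₀ := by
    simp only [hhx_def]
    rw [← map_sum, sum_localHam]
  have hsumo : (∑ x, ox x) = toEuclideanCLM (n := TensorIndex (TorusSite d (Lk k)) (n + 1)) (𝕜 := ℂ) O := by
    simp only [hox_def]
    rw [← map_sum]
    rfl
  have hsym_h : ∀ x, (hx x : SpinSpace (TorusSite d (Lk k)) (n + 1) →ₗ[ℂ] SpinSpace (TorusSite d (Lk k)) (n + 1)).IsSymmetric :=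
    fun x => isSymmetric_toEuclideanCLM_of_isHermitian (isHermitian_localHam n _ J Δ x)
  have hsym_o : ∀ x, (ox x : SpinSpace (TorusSite d (Lk k)) (n + 1) →ₗ[ℂ] SpinSpace (TorusSite d (Lk k)) (n + 1)).IsSymmetric :=
    fun x => isSymmetric_toEuclideanCLM_of_isHermitian (isHermitian_stagSign_smul_siteSpin n (σ k) x 2)
  have hhb : ∀ x, ‖hx x‖ ≤ hbar d n J Δ := fun x => by
    simp only [hhx_def]
    rw [Matrix.l2_opNorm_toEuclideanCLM]
    exact norm_localHam_le d (Lk k) n J Δ x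
  have hob : ∀ x, ‖ox x‖ ≤ sNorm n := fun x => by
    simp only [hox_def]
    rw [Matrix.l2_opNorm_toEuclideanCLM]
    exact norm_stagSign_smul_siteSpin_le n (σ k) x 2
  have hoo : ∀ x y, Commute (ox x) (ox y) := fun x y => by
    by_cases hxy : x = y
    · subst hxy
      exact Commute.refl _
    · exact commute_toEuclideanCLM_of_commute (commute_stagSign_smul_siteSpin n (σ k) hxy 2 2)
  have hho : ∀ x y, y ∉ nbhd d (Lk k) x → Commute (hx x) (ox y) := fun x y hy => by
    obtain ⟨hne, hadj⟩ := ne_and_not_adj_of_not_mem_nbhd d (Lk k) hy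
    exact commute_toEuclideanCLM_of_commute
      (commute_localHam_stagSign_smul_siteSpin n (σ k) (torusGraph d (Lk k)) J Δ hne hadj 2)
  have hsupp : ∀ x, (nbhd d (Lk k) x).card ≤ 2 * d + 2 := fun x => (card_nbhd_le d (Lk k) x).trans (by omega)
  -- the symmetric ground state `Φ_Λ` and its hypotheses
  have hΦ1 : ‖(toLp 2 Φ : SpinSpace (TorusSite d (Lk k)) (n + 1))‖ = 1 := norm_toLp_eq_one_of_dotProduct hΦ
  have hHΦ' : (∑ x, hx x) (toLp 2 Φ) = (H₀.groundEnergy : ℂ) • toLp 2 Φ := by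
    rw [hsumh, toEuclideanCLM_toLp, hHΦ, toLp_smul]
  have hground : ∀ ψ : SpinSpace (TorusSite d (Lk k)) (n + 1), ‖ψ‖ = 1 →
      H₀.groundEnergy ≤ (⟪ψ, (∑ x, hx x) ψ⟫_ℂ).re := fun ψ hψ => by
    rw [hsumh]
    exact Matrix.groundEnergy_le_re_inner_toEuclideanCLM' hH₀herm ψ hψ
  have hOΦ1 : ⟪(toLp 2 Φ : SpinSpace (TorusSite d (Lk k)) (n + 1)), (∑ x, ox x) (toLp 2 Φ)⟫_ℂ = 0 := by
    rw [hsumo, toEuclideanCLM_toLp, inner_toLp_toLp_eq_dotProduct, hO1]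
  have hlro3 : (μ * sNorm n * Fintype.card (TorusSite d (Lk k))) ^ 2 ≤
      (⟪(toLp 2 Φ : SpinSpace (TorusSite d (Lk k)) (n + 1)), (∑ x, ox x) ((∑ x, ox x) (toLp 2 Φ))⟫_ℂ).re := by
    rw [hsumo, toEuclideanCLM_toLp, toEuclideanCLM_toLp, inner_toLp_toLp_eq_dotProduct]
    exact hlro2
  have hOΦ3 : ⟪(toLp 2 Φ : SpinSpace (TorusSite d (Lk k)) (n + 1)),
      (∑ x, ox x) ((∑ x, ox x) ((∑ x, ox x) (toLp 2 Φ)))⟫_ℂ = 0 := by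
    rw [hsumo, toEuclideanCLM_toLp, toEuclideanCLM_toLp, toEuclideanCLM_toLp, inner_toLp_toLp_eq_dotProduct,
      Matrix.mulVec_mulVec, Matrix.mulVec_mulVec, hO3]
  -- the sourced ground state `Φ_Λ(B)`
  set HB := H₀ - (B : ℂ) • O with hHB_def
  have hHBherm : HB.IsHermitian :=
    hH₀herm.sub (hOherm.smul (by rw [isSelfAdjoint_iff, Complex.star_def, Complex.conj_ofReal]))
  have hfield : (∑ x, hx x) - (B : ℂ) • (∑ x, ox x) =
      toEuclideanCLM (n := TensorIndex (TorusSite d (Lk k)) (n + 1)) (𝕜 := ℂ) HB := by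
    rw [hsumh, hsumo, ← map_smul, ← map_sub]
  have hΦB1 : ‖(toLp 2 ΦB : SpinSpace (TorusSite d (Lk k)) (n + 1))‖ = 1 := norm_toLp_eq_one_of_dotProduct hΦB
  have hmin : ∀ ψ : SpinSpace (TorusSite d (Lk k)) (n + 1), ‖ψ‖ = 1 →
      (⟪(toLp 2 ΦB : SpinSpace (TorusSite d (Lk k)) (n + 1)),
          ((∑ x, hx x) - (B : ℂ) • (∑ x, ox x)) (toLp 2 ΦB)⟫_ℂ).re ≤
        (⟪ψ, ((∑ x, hx x) - (B : ℂ) • (∑ x, ox x)) ψ⟫_ℂ).re := fun ψ hψ => by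
    rw [hfield]
    exact Matrix.re_inner_toEuclideanCLM_le_of_groundState hHBherm hΦB hHB ψ hψ
  -- KT93 Theorem 7.1 (Kaplan–Horsch–von der Linden)
  have h := hN₀ hx ox (nbhd d (Lk k)) (sNorm n) (toLp 2 Φ) H₀.groundEnergy hsym_h hsym_o hhb hob hs hoo hho hsupp
    hΦ1 hHΦ' hground hOΦ1 hμ1 hlro3 hOΦ3 hNk hΦB1 hmin
  rw [hμs, hsumo, toEuclideanCLM_toLp, inner_toLp_toLp_eq_dotProduct] at h
  exact h

end Engine

/-! ### §5. The theorems for the model: the Ising side `Δ ≥ 1` -/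

section Models

/-- **XXZ ANTIFERROMAGNET ON THE ISING SIDE `Δ ≥ 1`, GROUND STATES: spontaneous NÉEL (staggered `z`) magnetisation
`≥ σ` under an infinitesimal staggered field — KT93 THEOREM 7.1 (Kaplan–Horsch–von der Linden) FOR ITS OWN MODEL.**
For every `d ≥ 2`, spin `S = n/2 ≥ ½` with `(d, S) ≠ (2, ½)`, `J > 0` and `Δ ≥ 1` there is `σ > 0` — a Néel long-range
order of the symmetric ground states (tree `xxzAF_ground_neel_of_ne`: Kubo–Kishi / Björnberg–Ueltschi; `Δ = 1` is
Kennedy–Lieb–Shastry's) — such that for every staggered field `B > 0` and every `ε > 0`, eventually on the even tori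
`Λ = (ℤ/(2k+2)ℤ)^d`, EVERY normalised ground state `Φ_B` of `H - B·O_Λ`,
`H = xxzHamiltonian n (torusGraph d (2k+2)) J Δ = JΣ_{⟨x,y⟩}(SˣSˣ+SʸSʸ+ΔSᶻSᶻ)`, `O_Λ = Σ_x(-1)^xSᶻ_x` (which does not
commute with `H`), satisfies **`N⁻¹ Re⟨Φ_B, O_ΛΦ_B⟩ ≥ σ - ε`**; i.e. `liminf_Λ N⁻¹(Φ_Λ(B), O_ΛΦ_Λ(B)) ≥ σ` for every
`B > 0`, hence (7.2).  Covers `d = 2`, `S ≥ 1`. [cite: KomaTasaki1993, Theorem 7.1 (7.2), §1 (1.1)–(1.2), p. 193]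
[cite: KaplanHorschVonDerLinden1989, main theorem] [cite: BjornbergUeltschi2022, Theorem 3.2] [cite: KuboKishi1988] -/
theorem xxzAF_ground_spontaneousNeelMagnetisation (hd : 2 ≤ d) {n : ℕ} (hn : 1 ≤ n) (hdn : ¬ (d = 2 ∧ n = 1))
    {J : ℝ} (hJ : 0 < J) {Δ : ℝ} (hΔ : 1 ≤ Δ) :
    ∃ σ : ℝ, 0 < σ ∧ ∀ B : ℝ, 0 < B → ∀ ε : ℝ, 0 < ε → ∀ᶠ k : ℕ in atTop,
      ∀ ΦB : TensorIndex (TorusSite d (2 * k + 2)) (n + 1) → ℂ, star ΦB ⬝ᵥ ΦB = 1 →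
        (xxzHamiltonian n (torusGraph d (2 * k + 2)) J Δ -
            (B : ℂ) • stagSpin n (torusParityExp d (2 * k + 2)) 2) *ᵥ ΦB =
          ((xxzHamiltonian n (torusGraph d (2 * k + 2)) J Δ -
              (B : ℂ) • stagSpin n (torusParityExp d (2 * k + 2)) 2).groundEnergy : ℂ) • ΦB →
        σ - ε ≤
          (star ΦB ⬝ᵥ (stagSpin n (torusParityExp d (2 * k + 2)) 2 *ᵥ ΦB)).re /
            (Fintype.card (TorusSite d (2 * k + 2)) : ℝ) := by
  obtain ⟨a, ha, hlro⟩ :=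
    exists_pos_eventually_le_of_hasStaggeredEvenTorusLRO_comp 2 (xxzAF_ground_neel_of_ne hd hn hdn hJ hΔ)
  exact ⟨Real.sqrt a, Real.sqrt_pos.2 ha, fun B hB ε hε =>
    ground_neelOrder_ge_of_eventually_lro (fun k => 2 * k + 2) (fun k => torusParityExp d (2 * k + 2)) ha
      (tendsto_card_torusSite_two_mul_add_two (by omega)) hlro hB hε⟩

/-- **The spin-½ XXZ antiferromagnet on `ℤ²`, Ising side `Δ ≥ 9/4`** (the tree's certified Néel window
`xxzAF_ground_neel_spinHalf_plaquette`; print: `Δ ≥ 1.78` Kubo–Kishi 1988): spontaneous Néel magnetisation `≥ σ` in the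
ground states under an infinitesimal staggered field, same form as `xxzAF_ground_spontaneousNeelMagnetisation` with
`d = 2`, `n = 1`. [cite: KomaTasaki1993, Theorem 7.1 (7.2)] [cite: KuboKishi1988]
[cite: WischmannMullerhartmann1991, Abstract (p. 647) and §1 (p. 648)] -/
theorem xxzAF_ground_spontaneousNeelMagnetisation_spinHalf_two {J : ℝ} (hJ : 0 < J) {Δ : ℝ} (hΔ : 9 / 4 ≤ Δ) :
    ∃ σ : ℝ, 0 < σ ∧ ∀ B : ℝ, 0 < B → ∀ ε : ℝ, 0 < ε → ∀ᶠ k : ℕ in atTop,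
      ∀ ΦB : TensorIndex (TorusSite 2 (2 * k + 2)) (1 + 1) → ℂ, star ΦB ⬝ᵥ ΦB = 1 →
        (xxzHamiltonian 1 (torusGraph 2 (2 * k + 2)) J Δ -
            (B : ℂ) • stagSpin 1 (torusParityExp 2 (2 * k + 2)) 2) *ᵥ ΦB =
          ((xxzHamiltonian 1 (torusGraph 2 (2 * k + 2)) J Δ -
              (B : ℂ) • stagSpin 1 (torusParityExp 2 (2 * k + 2)) 2).groundEnergy : ℂ) • ΦB →
        σ - ε ≤
          (star ΦB ⬝ᵥ (stagSpin 1 (torusParityExp 2 (2 * k + 2)) 2 *ᵥ ΦB)).re /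
            (Fintype.card (TorusSite 2 (2 * k + 2)) : ℝ) := by
  obtain ⟨a, ha, hlro⟩ :=
    exists_pos_eventually_le_of_hasStaggeredEvenTorusLRO_comp 2 (xxzAF_ground_neel_spinHalf_plaquette J hJ Δ hΔ)
  exact ⟨Real.sqrt a, Real.sqrt_pos.2 ha, fun B hB ε hε =>
    ground_neelOrder_ge_of_eventually_lro (fun k => 2 * k + 2) (fun k => torusParityExp 2 (2 * k + 2)) ha
      (tendsto_card_torusSite_two_mul_add_two one_le_two) hlro hB hε⟩

/-- **Ising side, tracial form**: eventually on the even tori the uniform mixture `ω_{GS,B}` of the ground states of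
`H - B·O_Λ` has `N⁻¹ Re ω_{GS,B}(O_Λ) ≥ σ - ε`. [cite: KomaTasaki1993, Theorem 7.1 (7.2), §1 (1.9)] -/
theorem xxzAF_ground_spontaneousNeelMagnetisation_groundStateFunctional (hd : 2 ≤ d) {n : ℕ} (hn : 1 ≤ n)
    (hdn : ¬ (d = 2 ∧ n = 1)) {J : ℝ} (hJ : 0 < J) {Δ : ℝ} (hΔ : 1 ≤ Δ) :
    ∃ σ : ℝ, 0 < σ ∧ ∀ B : ℝ, 0 < B → ∀ ε : ℝ, 0 < ε → ∀ᶠ k : ℕ in atTop,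
      σ - ε ≤
        ((xxzHamiltonian n (torusGraph d (2 * k + 2)) J Δ -
              (B : ℂ) • stagSpin n (torusParityExp d (2 * k + 2)) 2).groundStateFunctional
            (stagSpin n (torusParityExp d (2 * k + 2)) 2)).re /
          (Fintype.card (TorusSite d (2 * k + 2)) : ℝ) := by
  obtain ⟨σ, hσ, h⟩ := xxzAF_ground_spontaneousNeelMagnetisation hd hn hdn hJ hΔ
  refine ⟨σ, hσ, fun B hB ε hε => (h B hB ε hε).mono fun k hk => ?_⟩
  have hHB : (xxzHamiltonian n (torusGraph d (2 * k + 2)) J Δ -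
      (B : ℂ) • stagSpin n (torusParityExp d (2 * k + 2)) 2).IsHermitian :=
    (xxzHamiltonian_isHermitian n _ J Δ).sub ((isHermitian_stagSpin n _ 2).smul
      (by rw [isSelfAdjoint_iff, Complex.star_def, Complex.conj_ofReal]))
  exact le_re_groundStateFunctional_div_of_forall_groundState hHB _ (Nat.cast_nonneg _) hk

end Models

/-! ### §6. The isotropic point: the `z`-axis staggered field gives the same floor `√3 σ` -/

section Isotropic

/-- The quarter turn about the `y`-axis maps `O^{(3)} = Σ_x(-1)^{σx}Sᶻ_x` to `O^{(1)} = Σ_x(-1)^{σx}Sˣ_x`.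
[cite: Tasaki2020, §2.1 eq. (2.1.13)] [cite: KomaTasaki1993, §1 (1.2)] -/
theorem quarterTurnY_conj_stagSpin_two {Λ : Type*} [Fintype Λ] [DecidableEq Λ] (n : ℕ) (σ : Λ → ℕ) :
    quarterTurnY n * stagSpin n σ 2 * (quarterTurnY n)ᴴ = (stagSpin n σ 0 : Op Λ (n + 1)) := by
  rw [stagSpin, stagSpin, Finset.mul_sum, Finset.sum_mul]
  refine Finset.sum_congr rfl fun x _ => ?_
  rw [Matrix.mul_smul, Matrix.smul_mul, quarterTurnY_conj_siteSpin_two]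

/-- At the isotropic point the quarter turn is a symmetry: `Q H(J,1) Qᴴ = H(J,1)` (`SU(2)` invariance of `JΣ𝐒_x·𝐒_y`,
`commute_globalRotation_of_commute_totalSpin`). [cite: KomaTasaki1993, §2 (2.17), §1] [cite: Tasaki2020, §2.5 eq. (2.5.2)] -/
theorem quarterTurnY_conj_xxzHamiltonian_one {Λ : Type*} [Fintype Λ] [DecidableEq Λ] (n : ℕ) (G : SimpleGraph Λ)
    [DecidableRel G.Adj] (J : ℝ) :
    quarterTurnY n * xxzHamiltonian n G J 1 * (quarterTurnY n)ᴴ = xxzHamiltonian n G J 1 := by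
  have hc : Commute (xxzHamiltonian n G J 1) (quarterTurnY n) := by
    have h := commute_globalRotation_of_commute_totalSpin (fun α => commute_xxzHamiltonian_one_totalSpin n G J α)
      (Pi.single 1 (Real.pi / 2))
    rw [globalRotation_eq_productOp] at h
    exact h
  rw [← hc.eq, Matrix.mul_assoc, quarterTurnY_mul_conjTranspose, Matrix.mul_one]

/-- **HEISENBERG ANTIFERROMAGNET, GROUND STATES, `z`-AXIS STAGGERED FIELD: spontaneous Néel magnetisation `≥ √3 σ`.**
For `d ≥ 2`, `S = n/2` with `(d, S) ≠ (2, ½)`, `J > 0`: with the SAME `σ > 0` as in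
`XXZKT.heisenbergAF_ground_spontaneousStaggeredMagnetisation` (staggered `x`-field), for every `B > 0`, `ε > 0`, eventually on
the even tori, EVERY normalised ground state `Φ_B` of `H - B·Σ_x(-1)^xSᶻ_x`, `H = JΣ_{⟨x,y⟩}𝐒_x·𝐒_y`, has
`N⁻¹ Re⟨Φ_B, Σ_x(-1)^xSᶻ_xΦ_B⟩ ≥ √3 σ - ε`: the global quarter turn about the `y`-axis commutes with `H` and conjugates
`H - B·Σ(-1)^xSᶻ_x` to `H - B·Σ(-1)^xSˣ_x`, carrying ground states to ground states (`Matrix.groundEnergy_unitary_conj`).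
(KT93 Corollary 7.2 for the order parameter of its §1, improving Theorem 7.1's `σ` to `√3σ` at `Δ = 1`.)
[cite: KomaTasaki1993, Corollary 7.2 (7.3), Corollary 1.1, §1 (1.2)] [cite: KomaTasaki1994, Theorem 2.5 and Remark]
[cite: LiebMattis1962, Theorem 2] [cite: BjornbergUeltschi2022, Theorem 3.2] -/
theorem heisenbergAF_ground_spontaneousNeelMagnetisation (hd : 2 ≤ d) {n : ℕ} (hn : 1 ≤ n)
    (hdn : ¬ (d = 2 ∧ n = 1)) {J : ℝ} (hJ : 0 < J) :
    ∃ σ : ℝ, 0 < σ ∧ ∀ B : ℝ, 0 < B → ∀ ε : ℝ, 0 < ε → ∀ᶠ k : ℕ in atTop,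
      ∀ ΦB : TensorIndex (TorusSite d (2 * k + 2)) (n + 1) → ℂ, star ΦB ⬝ᵥ ΦB = 1 →
        (xxzHamiltonian n (torusGraph d (2 * k + 2)) J 1 -
            (B : ℂ) • stagSpin n (torusParityExp d (2 * k + 2)) 2) *ᵥ ΦB =
          ((xxzHamiltonian n (torusGraph d (2 * k + 2)) J 1 -
              (B : ℂ) • stagSpin n (torusParityExp d (2 * k + 2)) 2).groundEnergy : ℂ) • ΦB →
        Real.sqrt 3 * σ - ε ≤
          (star ΦB ⬝ᵥ (stagSpin n (torusParityExp d (2 * k + 2)) 2 *ᵥ ΦB)).re /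
            (Fintype.card (TorusSite d (2 * k + 2)) : ℝ) := by
  obtain ⟨σ, hσ, h⟩ := heisenbergAF_ground_spontaneousStaggeredMagnetisation hd hn hdn hJ
  refine ⟨σ, hσ, fun B hB ε hε => (h B hB ε hε).mono fun k hk ΦB hΦB hHB => ?_⟩
  -- the conjugation by the quarter turn `Q`
  set H := xxzHamiltonian n (torusGraph d (2 * k + 2)) J 1 with hH
  set Oz := stagSpin n (torusParityExp d (2 * k + 2)) 2 with hOz
  set Ox := stagSpin n (torusParityExp d (2 * k + 2)) 0 with hOx
  set Q : Op (TorusSite d (2 * k + 2)) (n + 1) := quarterTurnY n with hQ_def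
  have hQQ : Q * Qᴴ = 1 := quarterTurnY_mul_conjTranspose n
  have hQQ' : Qᴴ * Q = 1 := quarterTurnY_conjTranspose_mul n
  have hQH : Q * H * Qᴴ = H := quarterTurnY_conj_xxzHamiltonian_one n _ J
  have hQO : Q * Oz * Qᴴ = Ox := quarterTurnY_conj_stagSpin_two n _
  have hconj : Q * (H - (B : ℂ) • Oz) * Qᴴ = H - (B : ℂ) • Ox := by
    rw [Matrix.mul_sub, Matrix.sub_mul, Matrix.mul_smul, Matrix.smul_mul, hQH, hQO]
  have hQmem : Q ∈ Matrix.unitaryGroup (TensorIndex (TorusSite d (2 * k + 2)) (n + 1)) ℂ := by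
    rw [Matrix.mem_unitaryGroup_iff, star_eq_conjTranspose]
    exact hQQ
  have hE : (H - (B : ℂ) • Ox).groundEnergy = (H - (B : ℂ) • Oz).groundEnergy := by
    rw [← hconj, Matrix.groundEnergy_unitary_conj hQmem]
  -- `Ψ = QΦ_B` is a normalised ground state of `H - B·Oˣ`
  have hΨ1 : star (Q *ᵥ ΦB) ⬝ᵥ (Q *ᵥ ΦB) = 1 := by
    rw [star_mulVec, ← dotProduct_mulVec, mulVec_mulVec, hQQ', one_mulVec, hΦB]
  have hKQ : (H - (B : ℂ) • Ox) * Q = Q * (H - (B : ℂ) • Oz) := by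
    calc (H - (B : ℂ) • Ox) * Q = Q * (H - (B : ℂ) • Oz) * Qᴴ * Q := by rw [hconj]
      _ = Q * (H - (B : ℂ) • Oz) * (Qᴴ * Q) := by simp only [Matrix.mul_assoc]
      _ = Q * (H - (B : ℂ) • Oz) := by rw [hQQ', Matrix.mul_one]
  have hΨ : (H - (B : ℂ) • Ox) *ᵥ (Q *ᵥ ΦB) = ((H - (B : ℂ) • Ox).groundEnergy : ℂ) • (Q *ᵥ ΦB) := by
    rw [mulVec_mulVec, hKQ, ← mulVec_mulVec, hHB, mulVec_smul, hE]
  have hOxQ : Qᴴ * Ox * Q = Oz := by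
    calc Qᴴ * Ox * Q = Qᴴ * (Q * Oz * Qᴴ) * Q := by rw [hQO]
      _ = (Qᴴ * Q) * Oz * (Qᴴ * Q) := by simp only [Matrix.mul_assoc]
      _ = Oz := by rw [hQQ', Matrix.one_mul, Matrix.mul_one]
  have hval : star (Q *ᵥ ΦB) ⬝ᵥ (Ox *ᵥ (Q *ᵥ ΦB)) = star ΦB ⬝ᵥ (Oz *ᵥ ΦB) := by
    rw [star_mulVec, ← dotProduct_mulVec, mulVec_mulVec, mulVec_mulVec, hOxQ]
  have h1 := hk (Q *ᵥ ΦB) hΨ1 hΨ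
  rw [hval] at h1
  exact h1

end Isotropic

end XXZKT

end Literature.MathematicalPhysics.QuantumLattice
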